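import Mathlib
import HarnessLib
import Literature.Computability.AlgebraicComplexity.AsymptoticSubrankDuality
import Literature.Barriers.MatrixMultiplication.UnstableTensorBarrierThm17
import Summits.MatrixMultiplication.MatrixMultiplication.Theorems.OutsiderSandwichPairSandwich
import Summits.MatrixMultiplication.MatrixMultiplication.Theorems.OutsiderSandwichExchangeSpectral

/-!
# The pair tensor is `Q̃`-flat: `Q̃(P_{2^{N+1}}) = 2^{N+2}`, and the leaf's minimal-face transfer

Route `OutsiderSandwich` (decomposition cell `decomp-mm`, lens 4 «minimal counterexample /
extremal reduction», gen 30, kernel 2), support for the aside leaf `BlockOneIsMM`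
(stmt-MatrixMultiplication-27147: `θ⋆ = 0`, i.e. `F⟨2,2,2⟩ ≤ F(C₁)` at every universal spectral
point); the cut of record `closes(LaserTangency, LaserMergeOptimal, SummitIffLaserTangency)` is
untouched; theorem-only.

## Content

`OutsiderSandwichPairSandwich` reduced the level-`N` coupled block to ONE pair tensor
`P_n = [(A; u, w) ↦ (A u, Aᵀ w)]` (`n = 2^N`): `[P_{2^N}] ≤ [C₁]^N ≤ 2^{N-1}·[P_{2^N}]`.  Here the
extremal values of `P_n` on the asymptotic spectrum are computed exactly at powers of two:

* `le_map_pairTensor_two_pow` — **`F(P_{2^{N+1}}) ≥ 2^{N+2}`** at every universal spectral point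
  (`F(C₁) ≥ 4`, `OutsiderSandwichExchangeSpectral.four_le_map_coupling₁`, through the upper
  sandwich);
* `gaugePoint₂_le_card` / `asymptoticSubrank_pairTensor_le` — `ζ⁽²⁾(t) ≤ |κ|`, so `Q̃(P_n) ≤ 2n`
  (proved Strassen duality `strassen_duality_asymptoticSubrank_holds`;
  `Literature.Barriers.MatrixMultiplication.asymptoticSubrank_le_card₁₂₃`);
* `asymptoticSubrank_pairTensor_two_pow` — **`Q̃(P_{2^{N+1}}) = 2^{N+2} = |y-leg|`**: the pair
  tensor has the LARGEST asymptotic subrank its vector legs allow (it is `Q̃`-flat, like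
  `⟨n,n,n⟩`), the minimum over the spectrum being attained at the `y`-gauge point
  (`gaugePoint₂_pairTensor_two_pow`); for general `n`, `2^{N+2} ≤ Q̃(P_n) ≤ 2n` whenever
  `2^{N+1} ≤ n` (`pairTensor_mono`: `P_n ≥ P_m` for `m ≤ n`), so `Q̃(P_n) > n` for every `n ≥ 2`
  (`Q̃(P_1) = 1`);
* `map_matMul_eq_four_of_le` — **minimal-face transfer**: under the leaf, every universal
  spectral point on the minimal face of some `P_{2^{N+1}}` (`F(P_{2^{N+1}}) ≤ 2^{N+2}`) lies on the
  minimal face of `⟨2,2,2⟩` (`F⟨2,2,2⟩ = 4`); unconditionally so if `ω = 2`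
  (`map_matMul_eq_four_of_le_of_summit`).  Contrapositive (`not_blockOneIsMM_of_witness`): a
  universal spectral point with `F(P_{2^{N+1}}) = 2^{N+2}` and `F⟨2,2,2⟩ > 4` refutes the leaf —
  the extremal (lens-4) form of a counterexample in pair currency.

References: V. Strassen, *The asymptotic spectrum of tensors*, J. reine angew. Math. 384 (1988),
Thm. 3.8, (3.10) [Strassen1988]; M. Christandl, P. Vrana, J. Zuiddam, *Universal points in the
asymptotic spectrum of tensors*, J. Amer. Math. Soc. 36 (2023), Prop. 1.6, Ex. 1.4
[ChristandlVranaZuiddam2023]; D. Coppersmith, S. Winograd, J. Symbolic Comput. 9 (1990), §7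
[CoppersmithWinograd1990].
-/

noncomputable section

set_option linter.dupNamespace false

namespace Summit.MatrixMultiplication.MatrixMultiplication.Theorems.OutsiderSandwichPairSubrank

open Literature.Computability.AlgebraicComplexity
open Summit.MatrixMultiplication.MatrixMultiplication.Theorems.OutsiderSandwichCoupling (coupling₁)
open Summit.MatrixMultiplication.MatrixMultiplication.Theorems.OutsiderSandwichBlockNormalForm
  (pairTensor)
open Summit.MatrixMultiplication.MatrixMultiplication.Theorems.OutsiderSandwichPairSandwich
  (pairOn pairOn_fin map_sandwich blockOneIsMM_pair_reading)

/-! ## 1. `P_n ≥ P_m` for `m ≤ n` -/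

/-- Pulling `P_ρ` back along an injection `σ ↪ ρ` gives `P_σ`. [new] -/
theorem pairOn_comp_eq {ρ σ : Type} [DecidableEq ρ] [DecidableEq σ] (f : σ → ρ)
    (hf : Function.Injective f) :
    pairOn σ = fun a y z => pairOn ρ (Prod.map f f a) (Prod.map id f y) (Prod.map id f z) := by
  funext a y z
  simp only [pairOn, Prod.map_fst, Prod.map_snd, id_eq, hf.eq_iff]

/-- **`P_ρ ≥ P_σ` along any injection `σ ↪ ρ`.** [new] -/
theorem pairOn_restrictsTo_of_injective {ρ σ : Type} [Fintype ρ] [Fintype σ] [DecidableEq ρ]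
    [DecidableEq σ] (f : σ → ρ) (hf : Function.Injective f) :
    TensorRestrictsTo (pairOn ρ) (pairOn σ) := by
  rw [pairOn_comp_eq f hf]
  exact tensorRestrictsTo_precomp _ _ _ _

/-- **`P_n ≥ P_m` for `m ≤ n`.** [new] -/
theorem pairTensor_mono {m n : ℕ} (h : m ≤ n) : TensorRestrictsTo (pairTensor n) (pairTensor m) := by
  rw [← pairOn_fin, ← pairOn_fin]
  exact pairOn_restrictsTo_of_injective (Fin.castLE h) (Fin.castLE_injective h)

/-- `F(P_m) ≤ F(P_n)` for `m ≤ n` at every universal spectral point. [new] -/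
theorem map_pairTensor_mono {F : SpectralMap ℂ} (hF : IsUniversalSpectralPoint ℂ F) {m n : ℕ}
    (h : m ≤ n) : F (pairTensor m) ≤ F (pairTensor n) :=
  hF.mono _ _ (pairTensor_mono h)

/-! ## 2. The spectral floor `F(P_{2^{N+1}}) ≥ 2^{N+2}` -/

/-- **`2^{N+2} ≤ F(P_{2^{N+1}})`** at every universal spectral point: `4^{N+1} ≤ F(C₁)^{N+1} ≤
2^N · F(P_{2^{N+1}})`. [new] -/
theorem le_map_pairTensor_two_pow {F : SpectralMap ℂ} (hF : IsUniversalSpectralPoint ℂ F) (N : ℕ) :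
    (2 : ℝ) ^ (N + 2) ≤ F (pairTensor (2 ^ (N + 1))) := by
  have h4 : (4 : ℝ) ^ (N + 1) ≤ F coupling₁ ^ (N + 1) :=
    pow_le_pow_left₀ (by norm_num) (OutsiderSandwichExchangeSpectral.four_le_map_coupling₁ hF) _
  have key : (2 : ℝ) ^ N * 2 ^ (N + 2) ≤ 2 ^ N * F (pairTensor (2 ^ (N + 1))) := by
    calc (2 : ℝ) ^ N * 2 ^ (N + 2) = 4 ^ (N + 1) := by
          rw [← pow_add, show N + (N + 2) = 2 * (N + 1) by ring, pow_mul]; norm_num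
      _ ≤ F coupling₁ ^ (N + 1) := h4
      _ ≤ 2 ^ N * F (pairTensor (2 ^ (N + 1))) := (map_sandwich hF N).2
  exact le_of_mul_le_mul_left key (by positivity)

/-- `2^{N+2} ≤ F(P_n)` whenever `2^{N+1} ≤ n`. [new] -/
theorem le_map_pairTensor {F : SpectralMap ℂ} (hF : IsUniversalSpectralPoint ℂ F) {N n : ℕ}
    (hn : 2 ^ (N + 1) ≤ n) : (2 : ℝ) ^ (N + 2) ≤ F (pairTensor n) :=
  (le_map_pairTensor_two_pow hF N).trans (map_pairTensor_mono hF hn)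

/-! ## 3. The `y`-gauge ceiling and Strassen duality -/

/-- **`ζ⁽²⁾(t) ≤ |κ|`**: the `y`-flattening has rank at most the number of `y`-slices. [folklore] -/
theorem gaugePoint₂_le_card {ι κ μ : Type} [Fintype ι] [Fintype κ] [Fintype μ]
    (t : ι → κ → μ → ℂ) : gaugePoint₂ ℂ t ≤ Fintype.card κ := by
  rw [gaugePoint₂_eq_gaugePoint₁_swap, gaugePoint₁_eq]
  unfold flatteningRank
  exact_mod_cast finrank_range_le_card _

/-- `Q̃(P_n) ≤ 2n` (`Q̃(t) ≤ |κ|`, `Literature.Barriers…asymptoticSubrank_le_card₁₂₃`, through the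
proved Strassen duality `Q̃(t) ≤ ζ⁽²⁾(t)`). [cite: ChristandlVranaZuiddam2023, Prop. 1.6] -/
theorem asymptoticSubrank_pairTensor_le (n : ℕ) : asymptoticSubrank ℂ (pairTensor n) ≤ 2 * n := by
  simpa using (Literature.Barriers.MatrixMultiplication.asymptoticSubrank_le_card₁₂₃ (pairTensor n)).2.1

/-! ## 4. Exact values -/

/-- **`Q̃(P_{2^{N+1}}) = 2^{N+2}`**: the pair tensor on `2^{N+1} × 2^{N+1}` matrices is `Q̃`-flat.
[new] -/
theorem asymptoticSubrank_pairTensor_two_pow (N : ℕ) :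
    asymptoticSubrank ℂ (pairTensor (2 ^ (N + 1))) = 2 ^ (N + 2) := by
  obtain ⟨-, F, hF, hFeq⟩ := strassen_duality_asymptoticSubrank_holds ℂ (pairTensor (2 ^ (N + 1)))
  refine le_antisymm ?_ ?_
  · calc asymptoticSubrank ℂ (pairTensor (2 ^ (N + 1))) ≤ 2 * (2 ^ (N + 1) : ℕ) :=
          asymptoticSubrank_pairTensor_le _
      _ = 2 ^ (N + 2) := by push_cast; ring
  · rw [← hFeq]
    exact le_map_pairTensor_two_pow hF N

/-- `Q̃(P₂) = 4` (`= Q̃(C₁)`) and `Q̃(P₄) = 8`. [new] -/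
theorem asymptoticSubrank_pairTensor_two_four :
    asymptoticSubrank ℂ (pairTensor 2) = 4 ∧ asymptoticSubrank ℂ (pairTensor 4) = 8 :=
  ⟨by have h := asymptoticSubrank_pairTensor_two_pow 0; norm_num at h; exact h,
    by have h := asymptoticSubrank_pairTensor_two_pow 1; norm_num at h; exact h⟩

/-- For general `n`: `2^{N+2} ≤ Q̃(P_n) ≤ 2n` whenever `2^{N+1} ≤ n` (so `Q̃(P_n) > n` for every
`n ≥ 2`). [new] -/
theorem asymptoticSubrank_pairTensor_bounds {N n : ℕ} (hn : 2 ^ (N + 1) ≤ n) :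
    (2 : ℝ) ^ (N + 2) ≤ asymptoticSubrank ℂ (pairTensor n) ∧
      asymptoticSubrank ℂ (pairTensor n) ≤ 2 * n := by
  obtain ⟨-, F, hF, hFeq⟩ := strassen_duality_asymptoticSubrank_holds ℂ (pairTensor n)
  exact ⟨hFeq ▸ le_map_pairTensor hF hn, asymptoticSubrank_pairTensor_le n⟩

/-- **The minimum is attained at the `y`-gauge point: `ζ⁽²⁾(P_{2^{N+1}}) = 2^{N+2}`.** [new] -/
theorem gaugePoint₂_pairTensor_two_pow (N : ℕ) :
    gaugePoint₂ ℂ (pairTensor (2 ^ (N + 1))) = 2 ^ (N + 2) := by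
  refine le_antisymm ?_ (le_map_pairTensor_two_pow (gaugePoint₂_isUniversalSpectralPoint ℂ) N)
  calc gaugePoint₂ ℂ (pairTensor (2 ^ (N + 1))) ≤ Fintype.card (Fin 2 × Fin (2 ^ (N + 1))) :=
        gaugePoint₂_le_card _
    _ = 2 ^ (N + 2) := by simp; ring

/-- The sandwich is TIGHT at the bottom of the spectrum: at a universal point with
`F(P_{2^{N+1}}) ≤ 2^{N+2}` one has `F(C₁) = 4` (and `F(P_{2^{N+1}}) = 2^{N+2}`). [new] -/
theorem map_coupling₁_eq_four_of_le {F : SpectralMap ℂ} (hF : IsUniversalSpectralPoint ℂ F) {N : ℕ}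
    (hmin : F (pairTensor (2 ^ (N + 1))) ≤ 2 ^ (N + 2)) : F coupling₁ = 4 := by
  have h4 := OutsiderSandwichExchangeSpectral.four_le_map_coupling₁ hF
  refine le_antisymm ?_ h4
  have hpow : F coupling₁ ^ (N + 1) ≤ 4 ^ (N + 1) :=
    calc F coupling₁ ^ (N + 1) ≤ 2 ^ N * F (pairTensor (2 ^ (N + 1))) := (map_sandwich hF N).2
      _ ≤ 2 ^ N * 2 ^ (N + 2) := mul_le_mul_of_nonneg_left hmin (by positivity)
      _ = 4 ^ (N + 1) := by
          rw [← pow_add, show N + (N + 2) = 2 * (N + 1) by ring, pow_mul]; norm_num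
  exact (pow_le_pow_iff_left₀ (hF.nonneg _) (by norm_num) (Nat.succ_ne_zero N)).1 hpow

/-! ## 5. The leaf on the minimal face of the pair tensor -/

/-- **Minimal-face transfer**: under `BlockOneIsMM`, a universal spectral point on the minimal
face of `P_{2^{N+1}}` (`F(P_{2^{N+1}}) ≤ 2^{N+2}`) is on the minimal face of `⟨2,2,2⟩`:
`F⟨2,2,2⟩ = 4`. [new] -/
theorem map_matMul_eq_four_of_le (h : Theses.OutsiderSandwich.BlockOneIsMM) {F : SpectralMap ℂ}
    (hF : IsUniversalSpectralPoint ℂ F) {N : ℕ} (hmin : F (pairTensor (2 ^ (N + 1))) ≤ 2 ^ (N + 2)) :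
    F (matMulTensor ℂ 2 2 2) = 4 := by
  have h4 := OutsiderSandwichEdgeRigidity.four_le_map_matMulTensor_two hF
  refine le_antisymm ?_ h4
  have hle : F (matMulTensor ℂ 2 2 2) ≤ F coupling₁ := h F hF
  rw [← map_coupling₁_eq_four_of_le hF hmin]
  exact hle

/-- The same, unconditionally from `ω = 2`. [new] -/
theorem map_matMul_eq_four_of_le_of_summit (hS : _root_.MatrixMultiplication) {F : SpectralMap ℂ}
    (hF : IsUniversalSpectralPoint ℂ F) {N : ℕ} (hmin : F (pairTensor (2 ^ (N + 1))) ≤ 2 ^ (N + 2)) :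
    F (matMulTensor ℂ 2 2 2) = 4 :=
  map_matMul_eq_four_of_le (OutsiderSandwichBlockOne.blockOneIsMM_of_summit hS) hF hmin

/-- **The extremal counterexample shape in pair currency**: a universal spectral point minimal on
some `P_{2^{N+1}}` but not on `⟨2,2,2⟩` refutes the leaf (hence `ω = 2`). [new] -/
theorem not_blockOneIsMM_of_witness {F : SpectralMap ℂ} (hF : IsUniversalSpectralPoint ℂ F) {N : ℕ}
    (hmin : F (pairTensor (2 ^ (N + 1))) ≤ 2 ^ (N + 2)) (hgt : 4 < F (matMulTensor ℂ 2 2 2)) :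
    ¬ Theses.OutsiderSandwich.BlockOneIsMM := fun h =>
  absurd (map_matMul_eq_four_of_le h hF hmin) (ne_of_gt hgt)

/-- … and refutes `ω = 2`. [new] -/
theorem not_summit_of_witness {F : SpectralMap ℂ} (hF : IsUniversalSpectralPoint ℂ F) {N : ℕ}
    (hmin : F (pairTensor (2 ^ (N + 1))) ≤ 2 ^ (N + 2)) (hgt : 4 < F (matMulTensor ℂ 2 2 2)) :
    ¬ _root_.MatrixMultiplication := fun hS =>
  not_blockOneIsMM_of_witness hF hmin hgt (OutsiderSandwichBlockOne.blockOneIsMM_of_summit hS)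

end Summit.MatrixMultiplication.MatrixMultiplication.Theorems.OutsiderSandwichPairSubrank
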